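import Literature.MathematicalPhysics.QuantumFieldTheory.Balaban1983to89.T3ContinuumYM3Torus
import HarnessLib

/-!
# The carrier `T3Family` of the YM₃-on-T³ statements is inhabited

`T3ContinuumYM3Torus.T3Family` (block size `L` odd and `> 1`, volume exponent `m ≥ 1`; the `K`-th lattice is
`params3 L m K` of [Balaban1985UV3, (1)-(3) p.256]) is the binder of every R3 statement (`∀ F : T3Family, …`, or per block
size `∀ L, … ∀ F, F.L = L → …`).  This leaf records, as THEOREMS (no `instance`), that the binder is never vacuous: the
family is inhabited (`L = 3, m = 1`), every odd `L > 1` and every `m ≥ 1` is realised, and the realised block sizes are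
exactly the odd integers `> 1`.  The same anonymous-constructor term is built inline in several `Summits/…/Theorems`
files (`let F₀ : T3Family := ⟨L, ⟨hLo, hL1⟩, 1, le_rfl⟩`); here it is available by name.  These are API lemmas OF the cited structure (print's setting: the torus lattices `T^{(k)}` of
[Balaban1985UV3, (1)-(3) p.256] built with the block size of [Balaban1985Averaging, (1) p.17] «L is a fixed integer, L > 1»;
oddness of `L` is the tree's `Params` convention), not new results; count-neutral (tribunal chip «carrier-unverified»,
director-ym letter l-ym3-br 2026-08-27; the route OWNER ym3-torus-plan g23 accepted this Literature-lineage placement).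

References: T. Bałaban, Commun. Math. Phys. 102 (1985) 255–275 [Balaban1985UV3] ((1)-(3) p.256: the sequence of lattice
theories on the torus, `d = 3`); Commun. Math. Phys. 98 (1985) 17–51 [Balaban1985Averaging] ((1) p.17: the block size `L > 1`).
-/

namespace Literature.MathematicalPhysics.QuantumFieldTheory.Balaban1983to89

namespace T3ContinuumYM3Torus

namespace T3Family

/-- `T3Family` is inhabited: block size `L = 3`, volume exponent `m = 1` (API lemma of the structure `T3Family`). [cite: Balaban1985UV3, (1)-(3) p.256; Balaban1985Averaging, (1) p.17] -/
theorem nonempty_t3Family : Nonempty T3Family :=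
  ⟨⟨3, ⟨by decide, by decide⟩, 1, le_rfl⟩⟩

/-- Every odd block size `L > 1` is realised (with `m = 1`): the per-`L` binders `∀ F : T3Family, F.L = L → …` are never
vacuous for admissible `L` (API lemma of the structure `T3Family`). [cite: Balaban1985UV3, (1)-(3) p.256; Balaban1985Averaging, (1) p.17] -/
theorem exists_of_odd_one_lt {L : ℕ} (hL : Odd L ∧ 1 < L) : ∃ F : T3Family, F.L = L :=
  ⟨⟨L, hL, 1, le_rfl⟩, rfl⟩

/-- Every admissible pair (odd `L > 1`, `m ≥ 1`) is realised (API lemma of the structure `T3Family`). [cite: Balaban1985UV3, (1)-(3) p.256; Balaban1985Averaging, (1) p.17] -/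
theorem exists_of_odd_one_lt_of_one_le {L m : ℕ} (hL : Odd L ∧ 1 < L) (hm : 1 ≤ m) :
    ∃ F : T3Family, F.L = L ∧ F.m = m :=
  ⟨⟨L, hL, m, hm⟩, rfl, rfl⟩

/-- A block size is realised by some member of the family iff it is odd and `> 1` (API lemma of the structure `T3Family`). [cite: Balaban1985UV3, (1)-(3) p.256; Balaban1985Averaging, (1) p.17] -/
theorem exists_L_eq_iff {L : ℕ} : (∃ F : T3Family, F.L = L) ↔ Odd L ∧ 1 < L :=
  ⟨fun ⟨F, hF⟩ => hF ▸ F.hL, exists_of_odd_one_lt⟩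

/-- The realised block sizes are exactly the odd integers `> 1` (API lemma of the structure `T3Family`). [cite: Balaban1985UV3, (1)-(3) p.256; Balaban1985Averaging, (1) p.17] -/
theorem range_L : Set.range T3Family.L = {L | Odd L ∧ 1 < L} :=
  Set.ext fun _ => exists_L_eq_iff

end T3Family

end T3ContinuumYM3Torus

end Literature.MathematicalPhysics.QuantumFieldTheory.Balaban1983to89
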